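import Literature.AlgebraicGeometry.Frobenioids.ArchimedeanQuotientLiftingRigid
import HarnessLib

/-!
# Frobenioids II, Proposition 3.5 (i) for the rigidified angloid `R = R₀ ×_{D₀} D` — PROVED AS TYPED
# (no Galois-saturation hypothesis)

Mochizuki, *The geometry of Frobenioids II: poly-Frobenioids*, Kyushu J. Math. **62** (2008) 401–460,
§3, Proposition 3.5 (i), kurims p. 34 [cite: MochizukiFrdII2008, Prop 3.5 (i) p.34]:
"Let `A ∈ Ob(H)`; suppose that `B_D → A_D := Base(A)` is a mono-minimal categorical quotient of `B_D` by a
group `G_D ⊆ Aut_D(B_D)` in `D`. Then there exists a pull-back morphism `B → A` that lifts `B_D → A_D`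
and a group `G ⊆ Aut_H(B)` that maps isomorphically to `G_D` such that `B → A` is a mono-minimal
categorical quotient of `B` by `G` in `H`" — here for `H = R`, the RIGIDIFIED angloid of [FrdII] Ex. 3.3
(iv) (terminology via the natural functor `R → C`), i.e. abc-iut-L1-t9's instance `ArchFrd.Prop35i_R π`
(`ArchimedeanTheoremsInstances.lean`), over ANY functor `π : D → D₀`.

PROOF-ONLY companion of `ArchimedeanQuotientLiftingRigid.lean` (abc-iut-w4-d100 gen 0, p416558), which
proved the REPAIRED form `Prop35iR_R` (the printed item plus Galois saturation of the quotient datum,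
finding P35i-F1). For `H = C`, `A`, `N` the saturation hypothesis is genuinely needed (kernel witnesses
`not_prop35i_C_collapse`, and the `N`/`A` twins): a `Γ`-invariant arrow out of the complex lift `B` of a
real `A` may carry a non-real scalar (the phase twist `i · f`). For `H = R` it is IDLE, and this file
removes it: every object `X` of `R` carries a rigidification `X₀ → (real unit)` in `N₀`, arrows of `R`
commute with the rigidifications, and when `A` is real so is every `X` receiving a `Γ`-invariant arrow
`ψ : B → X` (the quotient in `D` supplies `A_D → X_D`); the commutation `ψ₀ ≫ r_X = r_B = (b,1,1) ≫ r_A`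
then reads `ρ_X · c_ψ = ρ_A` with `ρ_X, ρ_A ∈ ℝ^×` the (real) scalars of the rigidifications, so the
scalar `c_ψ` of `ψ` is REAL — which is exactly the descent that saturation was used for
(`QuotientLiftR.act_scalar_toC_mem`). The rest of gen 0's argument is unchanged:
* `QuotientLift.existsUnique_fac_of_act_scalar_mem` — the `C`-level factorisation through the lift of a
  `Γ`-invariant arrow whose transported scalar lies in the base field of `A` (the saturation-free core of
  `QuotientLift.isCategoricalQuotient_liftMor`);
* `QuotientLiftR.isCategoricalQuotient_liftMorR'`, `isMonoMinimalQuotient_liftMorR'` — no `hsat`;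
* **`QuotientLiftR.prop35i_R_holds : ArchFrd.Prop35i_R π`** and the alias **`ArchFrd.Prop35i_R_holds`**:
  the FACT-LIST row F-0860 (`Prop35i_R`, [FrdII] Prop. 3.5 (i) for `R`) is PROVED AS TYPED, for every
  functor `π : D → D₀` (no connectedness / total-epimorphicity / RC-type hypothesis is used beyond what the
  typed statement supplies).
Nothing here bears on [IUTchIII] Cor. 3.12; typed ≠ proved except where a `theorem` says so.
-/

namespace Literature.AlgebraicGeometry.Frobenioids

open CategoryTheory
open scoped Pointwise

noncomputable section

universe v u

namespace ArchFrd

/-! ### The saturation-free core of the `C`-level factorisation -/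

namespace QuotientLift

variable {D : Type u} [Category.{v} D] (π : D ⥤ D0) (A : C π) {BD : D} (fD : BD ⟶ A.snd)
  {GD : Subgroup (Aut BD)}

/-- **Factorisation through the lift, given descent of the scalar.** For a categorical quotient
`B_D → A_D` by `G_D` in `D` and a `Γ`-invariant arrow `ψ : B → X` of `C = C₀ ×_{D₀} D` out of the lift
`B` whose `C₀`-scalar, transported along the base arrow `b : Spec π(B_D) → Spec K_A`, is a scalar of
`K_A`, there is a unique `ψ' : A → X` with `(B → A) ≫ ψ' = ψ`. (This is the part of the printed argument
"it follows again from the simple, explicit structure of `H₀` …", p. 34, that does not depend on how the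
descent of the scalar is obtained.) [cite: MochizukiFrdII2008, Prop 3.5 (i) p.34] -/
theorem existsUnique_fac_of_act_scalar_mem (hq : IsCategoricalQuotient GD fD) {X : C π}
    (ψ : liftObj π A fD ⟶ X) (hψ : ∀ γ ∈ (liftAutHom π A fD GD hq.1).range, γ.hom ≫ ψ = ψ)
    (hc' : (liftBase π A fD).act (C0.scalar ψ.fst) ∈ D0.scalars A.fst.base) :
    ∃! ψ' : A ⟶ X, liftMor π A fD ≫ ψ' = ψ := by
  obtain ⟨δ, hδ, hδu⟩ := hq.2 ψ.snd (fun g hg => snd_invariant π A fD hq.1 ψ hψ g hg)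
  set cψ := C0.scalar ψ.fst with hcψ
  set dψ := C0.degFr ψ.fst with hdψ
  let β' : A.fst.base ⟶ X.fst.base := (baseIso π A).hom ≫ π.map δ ≫ (baseIso π X).inv
  have hβ : liftBase π A fD ≫ β' = C0.Base ψ.fst := by
    have w : C0.Base ψ.fst ≫ (baseIso π X).hom = 𝟙 _ ≫ π.map ψ.snd := ψ.w
    have w' : C0.Base ψ.fst ≫ (baseIso π X).hom = π.map fD ≫ π.map δ := by
      rw [← π.map_comp, hδ]
      exact w.trans (Category.id_comp _)
    rw [← cancel_mono (baseIso π X).hom, w']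
    simp only [liftBase, β', Category.assoc, Iso.inv_hom_id_assoc, Iso.inv_hom_id, Category.comp_id]
  let ψ₀' : A.fst ⟶ X.fst :=
    { base := β'
      degFr := dψ
      scalar := (liftBase π A fD).act cψ
      scalar_mem := hc'
      mapsTo := by
        have hm : cψ • (C0.pullRegion A.fst (liftBase π A fD)) ^ (dψ : ℕ) ⊆
            (liftBase π A fD).act '' C0.pullRegion X.fst β' := by
          have h0 := (ψ.fst).mapsTo
          rw [← C0.pullRegion_comp, hβ, ← liftRegion_carrier]
          exact h0
        unfold C0.pullRegion at hm ⊢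
        have hm' := Set.image_mono (f := (liftBase π A fD).act) hm
        rw [Set.image_smul_distrib, Set.image_pow, C0.act_image_act_image, C0.act_image_act_image] at hm'
        exact hm' }
  have hfst : liftFst π A fD ≫ ψ₀' = ψ.fst := by
    refine C0.hom_ext hβ ?_ ?_
    · change 1 * dψ = C0.degFr ψ.fst
      rw [one_mul]
    · change (liftBase π A fD).act ((liftBase π A fD).act cψ) * 1 ^ (dψ : ℕ) = C0.scalar ψ.fst
      rw [one_pow, mul_one]
      exact D0.galAct_galAct _ _
  let ψ' : A ⟶ X :=
    { fst := ψ₀'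
      snd := δ
      w := by
        change ((baseIso π A).hom ≫ π.map δ ≫ (baseIso π X).inv) ≫ (baseIso π X).hom =
          (baseIso π A).hom ≫ π.map δ
        simp only [Category.assoc, Iso.inv_hom_id, Category.comp_id] }
  refine ⟨ψ', CFP.hom_ext hfst hδ, ?_⟩
  intro y hy
  have hysnd : y.snd = δ := hδu y.snd (congrArg CFP.Hom.snd hy)
  have hyfst : liftFst π A fD ≫ y.fst = ψ.fst := congrArg CFP.Hom.fst hy
  refine CFP.hom_ext (C0.hom_ext ?_ ?_ ?_) hysnd
  · -- base
    have w : C0.Base y.fst ≫ (baseIso π X).hom = (baseIso π A).hom ≫ π.map y.snd := y.w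
    rw [hysnd] at w
    change C0.Base y.fst = (baseIso π A).hom ≫ π.map δ ≫ (baseIso π X).inv
    rw [← cancel_mono (baseIso π X).hom, w]
    simp only [Category.assoc, Iso.inv_hom_id, Category.comp_id]
  · -- degree
    have hd := congrArg C0.degFr hyfst
    change 1 * C0.degFr y.fst = dψ at hd
    rw [one_mul] at hd
    exact hd
  · -- scalar
    have hs := congrArg C0.scalar hyfst
    rw [C0.scalar_comp'] at hs
    change (liftBase π A fD).act (C0.scalar y.fst) * 1 ^ (C0.degFr y.fst : ℕ) = cψ at hs
    rw [one_pow, mul_one] at hs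
    change C0.scalar y.fst = (liftBase π A fD).act cψ
    rw [← hs]
    exact (D0.galAct_galAct _ _).symm

end QuotientLift

/-! ### The rigidification pins the scalar: Prop. 3.5 (i) for `R` as typed -/

namespace QuotientLiftR

variable {D : Type u} [Category.{v} D] (π : D ⥤ D0) (Q : ArchFrd.R π) {BD : D}
  (fD : BD ⟶ (QC π Q).snd) {GD : Subgroup (Aut BD)}

/-- If `A` is real, every object `X` of `R` receiving an arrow `A_D → X_D` of `D` is real.
[cite: MochizukiFrdII2008, §3 p.23] -/
theorem isReal_fst_base_of_hom {X : ArchFrd.R π} (δ : Q.snd ⟶ X.snd)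
    (hQ : (QC π Q).fst.base.IsReal) : (QC π X).fst.base.IsReal := by
  have h1 : (π.obj Q.snd).IsReal := UnitStab.D0.isReal_of_hom_real (QC π Q).iso.hom hQ
  have h2 : (π.obj X.snd).IsReal := UnitStab.D0.isReal_of_hom_real (π.map δ) h1
  exact UnitStab.D0.isReal_of_hom_real (QC π X).iso.inv h2

/-- The scalar of the rigidification of an object of `R` lies in the base field of the object.
[cite: MochizukiFrdII2008, Ex 3.3 (iv) p.29] -/
theorem scalar_rigid_mem (X : ArchFrd.R π) :
    C0.scalar (N0.homCarrier X.fst.hom) ∈ D0.scalars (QC π X).fst.base :=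
  (N0.homCarrier X.fst.hom).scalar_mem

/-- Rigidifications are linear. [cite: MochizukiFrdII2008, Ex 3.3 (iv) p.29] -/
theorem degFr_rigid (X : ArchFrd.R π) : C0.degFr (N0.homCarrier X.fst.hom) = 1 :=
  X.fst.hom.property

/-- **The rigidification pins the scalar.** For an arrow `ψ : B → X` of `R` out of the rigidified lift of a
quotient datum under `A ∈ Ob(R)`, and any arrow `A_D → X_D` of `D`, the `C₀`-scalar of `ψ` transported
along the base arrow `b` is a scalar of the base field `K_A` of `A`: trivial when `K_A = ℂ`; when
`K_A = ℝ`, `X` is real and `ψ₀ ≫ r_X = (b, 1, 1) ≫ r_A` gives `ρ_X · c_ψ = ρ_A` with real `ρ_X, ρ_A`.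
[cite: MochizukiFrdII2008, Prop 3.5 (i) p.34] -/
theorem act_scalar_toC_mem {X : ArchFrd.R π} (ψ : liftObjR π Q fD ⟶ X) (δ : Q.snd ⟶ X.snd) :
    (QuotientLift.liftBase π (QC π Q) fD).act (C0.scalar ((R.toC π).map ψ).fst) ∈
      D0.scalars (QC π Q).fst.base := by
  rcases D0.isReal_or_isComplex (QC π Q).fst.base with hQ | hQ
  · have hX : (QC π X).fst.base.IsReal := isReal_fst_base_of_hom π Q δ hQ
    have hsX : C0.scalar (N0.homCarrier X.fst.hom) ∈ D0.scalars D0.real := by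
      have hm := scalar_rigid_mem π X
      unfold D0.IsReal at hX
      rw [hX] at hm
      exact hm
    have hsB : C0.scalar (N0.homCarrier (liftR0 π Q fD).hom) ∈ D0.scalars D0.real :=
      scalar_rigid_mem_real π Q fD hQ
    have hw : N0.homCarrier ψ.fst.left ≫ N0.homCarrier X.fst.hom =
        N0.homCarrier (liftR0 π Q fD).hom :=
      congrArg N0.homCarrier (Over.w ψ.fst)
    have hs := congrArg C0.scalar hw
    rw [C0.scalar_comp', degFr_rigid π X, PNat.one_coe, pow_one] at hs
    unfold D0.Hom.act at hs
    rw [D0.galAct_eq_self_of_mem_scalars_real _ hsX] at hs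
    have hcψ : C0.scalar ((R.toC π).map ψ).fst ∈ D0.scalars D0.real := by
      have h' : C0.scalar (N0.homCarrier ψ.fst.left) =
          (C0.scalar (N0.homCarrier X.fst.hom))⁻¹ * C0.scalar (N0.homCarrier (liftR0 π Q fD).hom) := by
        rw [eq_inv_mul_iff_mul_eq]
        exact hs
      change C0.scalar (N0.homCarrier ψ.fst.left) ∈ _
      rw [h']
      exact mul_mem (inv_mem hsX) hsB
    unfold D0.IsReal at hQ
    have hsc : D0.scalars (QC π Q).fst.base = D0.scalars D0.real := by rw [hQ]
    rw [hsc]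
    unfold D0.Hom.act
    rw [D0.galAct_eq_self_of_mem_scalars_real _ hcψ]
    exact hcψ
  · unfold D0.IsComplex at hQ
    have hsc : D0.scalars (QC π Q).fst.base = ⊤ := by rw [hQ, D0.scalars_complex]
    rw [hsc]
    exact Subgroup.mem_top _

/-- **`B → A` is a categorical quotient of `B` by the lifted group IN `R` — for EVERY categorical quotient
`B_D → A_D` by `G_D` in `D` (no Galois saturation).** [cite: MochizukiFrdII2008, Prop 3.5 (i) p.34] -/
theorem isCategoricalQuotient_liftMorR' (hq : IsCategoricalQuotient GD fD) :
    IsCategoricalQuotient (liftAutHomR π Q fD GD hq.1).range (liftMorR π Q fD) := by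
  refine ⟨?_, ?_⟩
  · rintro γ ⟨g, rfl⟩
    apply (R.toC π).map_injective
    rw [Functor.map_comp]
    exact QuotientLift.liftAut_hom_comp_liftMor π (QC π Q) fD (g : Aut BD) (hq.1 g g.2)
  intro X ψ hψ
  have hψC : ∀ γ ∈ (QuotientLift.liftAutHom π (QC π Q) fD GD hq.1).range,
      γ.hom ≫ (R.toC π).map ψ = (R.toC π).map ψ := by
    rintro γ ⟨g, rfl⟩
    have h := congrArg (R.toC π).map (hψ (liftAutHomR π Q fD GD hq.1 g) ⟨g, rfl⟩)
    rw [Functor.map_comp] at h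
    exact h
  obtain ⟨δ, -, -⟩ := hq.2 ψ.snd
    (fun g hg => QuotientLift.snd_invariant π (QC π Q) fD hq.1 ((R.toC π).map ψ) hψC g hg)
  obtain ⟨ψ', hψ', hu⟩ :=
    QuotientLift.existsUnique_fac_of_act_scalar_mem π (QC π Q) fD hq ((R.toC π).map ψ) hψC
      (act_scalar_toC_mem π Q fD ψ δ)
  have hisoψ : PreFrobenioid.IsIsometry (C.toElem π) ((R.toC π).map ψ) :=
    (PreFrobenioid.isIsometry_fiberProduct_iff _).2 ψ.fst.left.hom.property
  have hiso : PreFrobenioid.IsIsometry C0.toElem ψ'.fst :=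
    (PreFrobenioid.isIsometry_fiberProduct_iff _).1 (C.isIsometry_of_fac π _ ψ' (hψ' ▸ hisoψ)).2
  have hlin : C0.degFr ψ'.fst = 1 :=
    (PreFrobenioid.isLinear_factors (C.toElem π) (β := QuotientLift.liftMor π (QC π Q) fD) (α := ψ')
      (hψ' ▸ (show PreFrobenioid.IsLinear (C.toElem π) ((R.toC π).map ψ) from ψ.fst.left.property))).1
  let ψR : Q ⟶ X :=
    ⟨Over.homMk (N0.homMk ψ'.fst hiso hlin) (N0.hom_ext (rigid_of_comp π Q fD ψ ψ' hψ')), ψ'.snd, ψ'.w⟩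
  have hmap : (R.toC π).map ψR = ψ' := rfl
  refine ⟨ψR, ?_, fun y hy => ?_⟩
  · apply (R.toC π).map_injective
    rw [Functor.map_comp, hmap]
    exact hψ'
  · apply (R.toC π).map_injective
    rw [hmap]
    refine hu _ ?_
    have h := congrArg (R.toC π).map hy
    rw [Functor.map_comp] at h
    exact h

/-- **`B → A` is a MONO-MINIMAL categorical quotient of `B` by the lifted group IN `R`** whenever
`B_D → A_D` is a mono-minimal categorical quotient by `G_D` in `D` (no Galois saturation).
[cite: MochizukiFrdII2008, Prop 3.5 (i) p.34] -/
theorem isMonoMinimalQuotient_liftMorR' (hq : IsMonoMinimalQuotient GD fD) :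
    IsMonoMinimalQuotient (liftAutHomR π Q fD GD hq.1.1).range (liftMorR π Q fD) :=
  ⟨isCategoricalQuotient_liftMorR' π Q fD hq.1, fun _ ζ φ' hfac hmono hgrp =>
    isIso_of_minimal π Q fD ζ φ' hfac hq hmono hgrp⟩

/-- **[FrdII] Proposition 3.5 (i) for `H = R` — PROVED AS TYPED** (abc-iut-L1-t9's instance `Prop35i_R`;
FACT-LIST F-0860), over any functor `π : D → D₀`: the rigidified lift `B := ((A_K|_{π B_D} → A₀ → unit),
B_D) → A` is a pull-back morphism (of `C`, via `R → C`) lifting `B_D → A_D`, the lifted group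
`Γ ⊆ Aut_R(B)` maps isomorphically to `G_D`, and `B → A` is a mono-minimal categorical quotient of `B` by
`Γ` in `R`. [cite: MochizukiFrdII2008, Prop 3.5 (i) p.34] -/
theorem prop35i_R_holds : Literature.AlgebraicGeometry.Frobenioids.ArchFrd.Prop35i_R π := by
  intro _ Q BD fD GD hq
  change BD ⟶ Q.snd at fD
  refine ⟨liftObjR π Q fD, liftMorR π Q fD, Iso.refl _, (liftAutHomR π Q fD GD hq.1.1).range,
    (MonoidHom.ofInjective (liftAutHomR_injective π Q fD GD hq.1.1)).symm,
    QuotientLift.isPullbackMorphism_liftMor π (QC π Q) fD, (Category.id_comp _).symm, fun γ => ?_,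
    isMonoMinimalQuotient_liftMorR' π Q fD hq⟩
  have h1 := MonoidHom.apply_ofInjective_symm (liftAutHomR_injective π Q fD GD hq.1.1) γ
  have h2 : (((MonoidHom.ofInjective (liftAutHomR_injective π Q fD GD hq.1.1)).symm γ : GD) :
      Aut BD).hom = (γ : Aut (liftObjR π Q fD)).hom.snd :=
    congrArg (fun k : Aut (liftObjR π Q fD) => k.hom.snd) h1
  exact (Category.comp_id _).trans (h2.symm.trans (Category.id_comp _).symm)

end QuotientLiftR

variable {D : Type u} [Category.{v} D] (π : D ⥤ D0)

/-- **[FrdII] Prop. 3.5 (i) for `H = R` AS TYPED — discharge of the named statement `Prop35i_R`**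
(FACT-LIST F-0860; alias of `QuotientLiftR.prop35i_R_holds`). [cite: MochizukiFrdII2008, Prop 3.5 (i) p.34] -/
theorem Prop35i_R_holds : Literature.AlgebraicGeometry.Frobenioids.ArchFrd.Prop35i_R π :=
  QuotientLiftR.prop35i_R_holds π

end ArchFrd

end

end Literature.AlgebraicGeometry.Frobenioids
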